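/-
Copyright (c) 2026. All rights reserved.
Released under Apache 2.0 license as described in the file LICENSE.
-/
import Literature.NumberTheory.Weil1964.ArchFollandCompact
import Literature.NumberTheory.Weil1964.ArchActQuadraticPlaces
import Literature.RepresentationTheory.KonnoKonno2007.JunctionVacuumSectionSwap
import Literature.NumberTheory.Automorphic.UnitaryGroupFormTransport
import Literature.NumberTheory.GelbartRogawski1991.UnitaryDualPairGramDiagonal
import HarnessLib

/-!
# The archimedean dual pair `U(V_v) × U(W_v) ↪ Sp(𝕎_v)` in adapted Folland coordinates = Konno–Konno's `ι𝕎`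

Topic `NumberTheory/Weil1964`; namespace `Literature.NumberTheory.Weil1964`.  KERNEL MATHEMATICS ONLY: transparent
auxiliary definitions (`signOf`, `scaleGL`, `scaleConj`, `pairScale`, `pairFrame`, `toUForm`, `archUForm`,
`archPairPlace`) and proved theorems; **no `def … : Prop` record, no axiom, no proof hole**.

**The dictionary.**  `ArchFollandCompact` computed, in the ADAPTED Folland frame `(p, q) = (D a, -D⁻¹ T b)`
(`im σ_w(δ) · D_j² = ε_j t_j`, `ε_j = ±1`) of a real DIAGONAL Gram matrix `T = diag(t)`, the phase-space map of every
SIGN-BLOCK `k ∈ U(diag t)`: a genuine unitary `realify (follandUnitary k)`.  This file does the computation for an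
ARBITRARY complex matrix `K` (§2): the phase-space map of `x ↦ K x` is the SIGN-TWISTED realification

  `(p + iq) ↦ twε (D K D⁻¹ · twε (p + iq))`,  `twε` = complex conjugation on the coordinates with `ε_j = +1`

(`phasePt_follandScale_resEnd`) — which, once the coordinates are sorted by sign along a bijection `φ : n ≃ α ⊕ β`
(`ε = signOf ∘ φ`), is LITERALLY Konno–Konno's twisted realification `twRealify` of `RealUnitaryDualPair`, transported
along `φ` by `reindexPhase` of `JunctionVacuumSectionSwap` (`follandScale_resEnd_eq_reindexPhase_twRealify`).  For the
dual pair — `K = (k₁ ⊗ k₂)^e` on the index `Fin n ≃ Fin N × Fin M` of `V ⊗ W`, scaling `D = D_V ⊗ D_W` — the matrix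
`D K D⁻¹` sorted by the product sign frame `pairFrame e ε_V ε_W : Fin n ≃ DPIdx P Q R S` is the block matrix of
`toBig (g₁, g₂)`, `gᵢ = (Dᵢ kᵢ Dᵢ⁻¹)^{εᵢ} ∈ U(P,Q)`, resp. `U(R,S)` (§3, §4: a `diag(t)`-unitary matrix conjugated by
the adapted scaling and sorted by sign IS a `diag(1,−1)`-unitary matrix — Sylvester), so that the phase-space map of
the pair element is `reindexPhase (pairFrame …) (ι𝕎 P Q R S (g₁, g₂))` (`follandScale_resEnd_pair`).  §5 puts this at
every real place `v` of a totally real `F` under a CM-type quadratic `E/F` (`ArchActQuadraticPlaces (γ′)`): the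
`v`-slices of the archimedean action of `ι(u₁ ⊗ 1 · 1 ⊗ u₂) ∈ Sp(𝕎_𝔸)` in the scaled Folland frame are
`reindexPhase (pairFrame …) (ι𝕎 (archPairPlace v (u₁, u₂)))` with the CONTINUOUS HOMOMORPHISM
`archPairPlace v : U(J_V)(𝔸_F) × U(J_W)(𝔸_F) →* U(P_v,Q_v) × U(R_v,S_v) = Ginf` (`archPart`, `archAt (wOf v)`,
`toUForm`) (`archFolland_archAct_toSp_pair_slice`).  The consumer is the theta-majorant pin of the unitary dual pair
(`ArchDualPairThetaMajorants`): the archimedean datum of Weil's Théorème 6 for `U(V) × U(W)` is the product over the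
real places of Konno–Konno's real dual pairs, fed through `LeviKAKInput.places/reindex`.

Sources: Folland 1989, Ch. 4 §1 Prop. (4.6) p. 151 (the unitary group inside `Sp`, `(p,q) ↔ p + iq`) and §4.2 (4.24)
p. 156; Konno–Konno 2007 §3.1 (3.1) (`ι_{V,W} : G_V × G_W → Sp(𝕎)`); Mœglin–Vignéras–Waldspurger 1987 Ch. 1 I.17
(`U(V) × U(W) ⊂ Sp(V ⊗ W)`, real points `U(p,q)`); Gelbart–Rogawski 1991 §3.1 p. 454 (the unitary dual pair over a
CM-type quadratic extension); Platonov–Rapinchuk 1994 §2.3 (isometric forms have conjugate unitary groups).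
Tree: `ArchFollandCompact` (`signConj`, `phasePt_follandScale`), `ArchFollandTorus(Adelic)` (`follandScale`,
`scaledFrame`, `archFolland_scaledFrame`, `placeVec`), `ArchActQuadraticPlaces` (`placeVec_archAct_toSp_inl_mul_inr`),
`KonnoKonno2007.RealUnitaryDualPair` (`tw`, `twRealify`, `signForm`, `UForm`, `dpEquiv`, `Ginf`, `ι𝕎`, `ι𝕎_apply`),
`KonnoKonno2007.JunctionVacuumSectionSwap` (`reindexPhase`), `Automorphic.UnitaryGroupFormTransport`
(`unitaryGroupOfFormCongrOfEq`, `unitaryGroupOfFormReindex`), `GelbartRogawski1991.UnitaryDualPairGramDiagonal`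
(`adelicGram_diagonal`).

## Provenance

Written under the LEAN-IN-TREE rule for the pub-hodgecm formalisation cell (node W2-wm.maj, the archimedean half of the
theta-majorant pin of the CM unitary dual pair); KERNEL only.  Nothing here is a claim of the sources beyond the cited
dictionary; all statements are proved.
-/

open scoped Matrix Real Classical ComplexConjugate Kronecker
open Complex NumberField NumberField.InfinitePlace NumberField.mixedEmbedding IsDedekindDomain
open Literature.NumberTheory.Automorphic Literature.NumberTheory.Automorphic.UnitaryGroup
open Literature.RepresentationTheory.HeisenbergGroup Literature.Analysis.SegalBargmann
open Literature.RepresentationTheory.KonnoKonno2007 Literature.RepresentationTheory.KonnoKonno2007.RealDualPair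

noncomputable section

namespace Literature.NumberTheory.Weil1964

local notation "PV" σ => (σ → ℝ) × (σ → ℝ)

/-! ## §1 Sign frames, the twist, and the adapted diagonal scaling as a change of basis -/

section SignFrame

variable {n : Type*} {α β : Type*}

/-- **The sign label of a two-block frame**: `+1` on the `Sum.inl` block, `-1` on the `Sum.inr` block (the diagonal of
Konno–Konno's `signForm α β = diag(1_α, -1_β)`, as a real number). [folklore] -/
def signOf (x : α ⊕ β) : ℝ := Sum.elim (fun _ => (1 : ℝ)) (fun _ => -1) x

/-- `signOf (inl a) = 1`. [folklore] -/
@[simp] theorem signOf_inl (a : α) : signOf (Sum.inl a : α ⊕ β) = 1 := rfl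

/-- `signOf (inr b) = -1`. [folklore] -/
@[simp] theorem signOf_inr (b : β) : signOf (Sum.inr b : α ⊕ β) = -1 := rfl

/-- `signOf x = ±1`. [folklore] -/
theorem signOf_eq_one_or (x : α ⊕ β) : signOf x = 1 ∨ signOf x = -1 := by
  cases x
  · exact Or.inl rfl
  · exact Or.inr rfl

/-- `(signOf x : ℂ)` is the diagonal entry of `signForm`. [folklore] -/
theorem ofReal_signOf (x : α ⊕ β) : ((signOf x : ℝ) : ℂ) = Sum.elim (fun _ => (1 : ℂ)) (fun _ => -1) x := by
  cases x
  · simp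
  · simp

/-- **`signConj` for the sign vector `signOf ∘ φ` IS Konno–Konno's twist `tw`, transported along `φ : n ≃ α ⊕ β`**
(conjugation exactly on the coordinates sorted into the `+1` block). [folklore] -/
theorem signConj_signOf_eq_tw (φ : n ≃ α ⊕ β) (y : n → ℂ) (i : n) :
    signConj (fun j => signOf (φ j)) i (y i) = tw (y ∘ φ.symm) (φ i) := by
  show (if signOf (φ i) = 1 then conj (y i) else y i) = tw (y ∘ φ.symm) (φ i)
  rcases hφ : φ i with a | b
  · rw [signOf_inl, if_pos rfl, tw_inl, Function.comp_apply, ← hφ, Equiv.symm_apply_apply]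
    rfl
  · rw [signOf_inr, if_neg (by norm_num), tw_inr, Function.comp_apply, ← hφ, Equiv.symm_apply_apply]

/-- vector form of `signConj_signOf_eq_tw`. [folklore] -/
theorem signConj_signOf_eq_tw' (φ : n ≃ α ⊕ β) (y : n → ℂ) :
    (fun i => signConj (fun j => signOf (φ j)) i (y i)) = tw (y ∘ φ.symm) ∘ φ :=
  funext fun i => signConj_signOf_eq_tw φ y i

/-- **`D K D⁻¹`**: the matrix `K` conjugated by a real diagonal scaling, entries `D_i K_{ij} / D_j`. [folklore] -/
def scaleConj (D : n → ℝ) (K : Matrix n n ℂ) : Matrix n n ℂ := Matrix.of fun i j => (D i : ℂ) * K i j * ((D j : ℂ))⁻¹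

/-- entries of `scaleConj D K`. [folklore] -/
@[simp] theorem scaleConj_apply (D : n → ℝ) (K : Matrix n n ℂ) (i j : n) :
    scaleConj D K i j = (D i : ℂ) * K i j * ((D j : ℂ))⁻¹ := rfl

variable [Fintype n] [DecidableEq n]

/-- **The real diagonal scaling `diag(D)`, `D_j ≠ 0`, as an element of `GLₙ(ℂ)`** (the change of basis to the adapted
Folland frame). [folklore] -/
def scaleGL (D : n → ℝ) (hD : ∀ j, D j ≠ 0) : GL n ℂ where
  val := Matrix.diagonal fun j => (D j : ℂ)
  inv := Matrix.diagonal fun j => ((D j : ℂ))⁻¹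
  val_inv := by
    rw [Matrix.diagonal_mul_diagonal, ← Matrix.diagonal_one]
    exact congrArg Matrix.diagonal (funext fun j => mul_inv_cancel₀ (Complex.ofReal_ne_zero.2 (hD j)))
  inv_val := by
    rw [Matrix.diagonal_mul_diagonal, ← Matrix.diagonal_one]
    exact congrArg Matrix.diagonal (funext fun j => inv_mul_cancel₀ (Complex.ofReal_ne_zero.2 (hD j)))

/-- matrix of `scaleGL D`. [folklore] -/
@[simp] theorem coe_scaleGL (D : n → ℝ) (hD : ∀ j, D j ≠ 0) :
    ((scaleGL D hD : GL n ℂ) : Matrix n n ℂ) = Matrix.diagonal fun j => (D j : ℂ) := rfl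

/-- matrix of `(scaleGL D)⁻¹`. [folklore] -/
@[simp] theorem coe_scaleGL_inv (D : n → ℝ) (hD : ∀ j, D j ≠ 0) :
    (((scaleGL D hD)⁻¹ : GL n ℂ) : Matrix n n ℂ) = Matrix.diagonal fun j => ((D j : ℂ))⁻¹ := rfl

/-- `diag(D) · K · diag(D)⁻¹ = scaleConj D K`. [folklore] -/
theorem scaleGL_mul_mul_inv (D : n → ℝ) (hD : ∀ j, D j ≠ 0) (K : Matrix n n ℂ) :
    ((scaleGL D hD : GL n ℂ) : Matrix n n ℂ) * K * (((scaleGL D hD)⁻¹ : GL n ℂ) : Matrix n n ℂ) = scaleConj D K := by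
  ext i j
  rw [coe_scaleGL_inv, Matrix.mul_diagonal, coe_scaleGL, Matrix.diagonal_mul, scaleConj_apply]

/-- on `GLₙ(ℂ)`: the matrix of `diag(D) k diag(D)⁻¹` is `scaleConj D k`. [folklore] -/
theorem coe_scaleGL_conj (D : n → ℝ) (hD : ∀ j, D j ≠ 0) (k : GL n ℂ) :
    ((scaleGL D hD * k * (scaleGL D hD)⁻¹ : GL n ℂ) : Matrix n n ℂ) = scaleConj D (k : Matrix n n ℂ) := by
  rw [Units.val_mul, Units.val_mul, scaleGL_mul_mul_inv]

end SignFrame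

/-! ## §2 The phase-space map of an arbitrary complex matrix in adapted Folland coordinates -/

section Folland

variable {n : Type*} [Fintype n] [DecidableEq n]
variable {Ψ : (ℝ × ℝ) ≃+ ℂ} {δ' : ℂ} {d : ℝ} (h : IsQuadraticCoordinates Complex.ofRealHom Ψ δ' d)
include h

omit [Fintype n] [DecidableEq n] in
/-- `phasePt` of the adapted Folland scaling of `reIm y`: `D_j · signConj ε j (y_j)`. [cite: Folland1989, Ch. 4 §1,
Prop. (4.6) p. 151] -/
theorem phasePt_follandScale_reIm (hre : δ'.re = 0) {t D ε : n → ℝ} (hD : ∀ j, δ'.im * D j ^ 2 = ε j * t j)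
    (hε : ∀ j, ε j = 1 ∨ ε j = -1) (hD0 : ∀ j, D j ≠ 0) (y : n → ℂ) :
    phasePt (follandScale D t (QuadraticCoordinates.reIm Ψ n y)).1
        (follandScale D t (QuadraticCoordinates.reIm Ψ n y)).2 = fun j => (D j : ℂ) * signConj ε j (y j) := by
  funext j
  rw [show QuadraticCoordinates.reIm Ψ n y =
      ((QuadraticCoordinates.reIm Ψ n y).1, (QuadraticCoordinates.reIm Ψ n y).2) from rfl,
    phasePt_follandScale h hre hD hε hD0, QuadraticCoordinates.reIm_apply_fst, QuadraticCoordinates.reIm_apply_snd,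
    QuadraticCoordinates.apply_re_im]

/-- **The phase-space map of `x ↦ K x` (ANY `K ∈ Mₙ(ℂ)`) in adapted Folland coordinates is the sign-twisted conjugate
`D K D⁻¹`**: with `twε y := (signConj ε j (y j))_j`,
`p' + iq' = twε (D K D⁻¹ · twε (p + iq))` for `(p, q) = follandScale (a, b)`, `(p', q') = follandScale (K(a, b))`.
(For a sign-block `T`-unitary `k`, `twε ∘ (D k D⁻¹) ∘ twε` is the genuine unitary `follandUnitary k` of
`ArchFollandCompact.follandScale_resAut_eq_realify`.) [cite: Folland1989, Ch. 4 §1, Prop. (4.6) p. 151] -/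
theorem phasePt_follandScale_resEnd (hre : δ'.re = 0) {t D ε : n → ℝ} (hD : ∀ j, δ'.im * D j ^ 2 = ε j * t j)
    (hε : ∀ j, ε j = 1 ∨ ε j = -1) (hD0 : ∀ j, D j ≠ 0) (K : Matrix n n ℂ) (ab : PV n) :
    phasePt (follandScale D t (h.resEnd n K ab)).1 (follandScale D t (h.resEnd n K ab)).2 = fun i =>
      signConj ε i ((scaleConj D K *ᵥ fun j =>
        signConj ε j (phasePt (follandScale D t ab).1 (follandScale D t ab).2 j)) i) := by
  set x : n → ℂ := (QuadraticCoordinates.reIm Ψ n).symm ab with hx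
  have hab : ab = QuadraticCoordinates.reIm Ψ n x := ((QuadraticCoordinates.reIm Ψ n).apply_symm_apply ab).symm
  rw [hab, h.resEnd_reIm, phasePt_follandScale_reIm h hre hD hε hD0, phasePt_follandScale_reIm h hre hD hε hD0]
  have hv : ∀ j, signConj ε j ((D j : ℂ) * signConj ε j (x j)) = (D j : ℂ) * x j := fun j => by
    rw [signConj_mul, signConj_ofReal, signConj_signConj]
  funext i
  simp only [hv]
  simp only [Matrix.mulVec, dotProduct, scaleConj_apply]
  rw [signConj_sum, signConj_sum, Finset.mul_sum]
  refine Finset.sum_congr rfl fun j _ => ?_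
  have hj : (D j : ℂ) ≠ 0 := Complex.ofReal_ne_zero.2 (hD0 j)
  rw [mul_assoc ((D i : ℂ) * K i j), inv_mul_cancel_left₀ hj, mul_assoc, signConj_mul ε i ((D i : ℂ)),
    signConj_ofReal]

omit h in
omit [Fintype n] [DecidableEq n] in
/-- `phasePt` of a reindexed twisted realification. [folklore] -/
theorem phasePt_reindexPhase_twRealify {α β : Type*} [Fintype α] [Fintype β] [DecidableEq α] [DecidableEq β]
    (φ : n ≃ α ⊕ β) (X : Matrix (α ⊕ β) (α ⊕ β) ℂ) (pq : PV n) :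
    phasePt (reindexPhase φ (twRealify X) pq).1 (reindexPhase φ (twRealify X) pq).2 =
      twMulVec X (phasePt (pq.1 ∘ φ.symm) (pq.2 ∘ φ.symm)) ∘ φ := by
  show phasePt ((twRealify X (pq.1 ∘ φ.symm, pq.2 ∘ φ.symm)).1 ∘ φ)
      ((twRealify X (pq.1 ∘ φ.symm, pq.2 ∘ φ.symm)).2 ∘ φ) = _
  rw [phasePt_comp_equiv, phasePt_twRealify]

/-- **… and, the coordinates sorted by sign along `φ : n ≃ α ⊕ β` (`ε = signOf ∘ φ`), it is Konno–Konno's twisted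
realification `twRealify` of `(D K D⁻¹)^φ`, transported along `φ`:**
`follandScale (K(a, b)) = reindexPhase φ (twRealify (reindex φ φ (D K D⁻¹))) (follandScale (a, b))`.
[cite: Folland1989, Ch. 4 §1, Prop. (4.6) p. 151; KonnoKonno2007, §3.1 (3.1)] -/
theorem follandScale_resEnd_eq_reindexPhase_twRealify (hre : δ'.re = 0) {t D : n → ℝ} {α β : Type*} [Fintype α]
    [Fintype β] [DecidableEq α] [DecidableEq β] (φ : n ≃ α ⊕ β) (hD : ∀ j, δ'.im * D j ^ 2 = signOf (φ j) * t j)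
    (hD0 : ∀ j, D j ≠ 0) (K : Matrix n n ℂ) (ab : PV n) :
    follandScale D t (h.resEnd n K ab) =
      reindexPhase φ (twRealify (Matrix.reindex φ φ (scaleConj D K))) (follandScale D t ab) := by
  apply pv_ext
  rw [phasePt_follandScale_resEnd h hre hD (fun j => signOf_eq_one_or (φ j)) hD0 K ab,
    phasePt_reindexPhase_twRealify, phasePt_comp_equiv]
  set y : n → ℂ := phasePt (follandScale D t ab).1 (follandScale D t ab).2 with hy
  rw [signConj_signOf_eq_tw' φ y]
  funext i
  rw [signConj_signOf_eq_tw φ, Function.comp_apply, twMulVec, Matrix.reindex_apply, Matrix.submatrix_mulVec_equiv,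
    Equiv.symm_symm]

end Folland

/-! ## §3 The dual pair: `D (k₁ ⊗ k₂)^e D⁻¹` sorted by the product sign frame is `toBig (g₁, g₂)` -/

section Pair

variable {ιV ιW ι : Type*} {P Q R S : Type*}

/-- **The product scaling** `D_{e(i,i')} = D_V i · D_W i'` conjugates `(k₁ ⊗ k₂)^e` to `(D_V k₁ D_V⁻¹ ⊗ D_W k₂ D_W⁻¹)^e`.
[folklore] -/
theorem scaleConj_reindex_kronecker (e : ιV × ιW ≃ ι) (DV : ιV → ℝ) (DW : ιW → ℝ) (k₁ : Matrix ιV ιV ℂ)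
    (k₂ : Matrix ιW ιW ℂ) :
    scaleConj (fun k => DV (e.symm k).1 * DW (e.symm k).2) (Matrix.reindex e e (k₁ ⊗ₖ k₂)) =
      Matrix.reindex e e (scaleConj DV k₁ ⊗ₖ scaleConj DW k₂) := by
  ext i j
  simp only [scaleConj_apply, Matrix.reindex_apply, Matrix.submatrix_apply, Matrix.kroneckerMap_apply,
    Complex.ofReal_mul, mul_inv]
  ring

/-- reindexing a Kronecker product along a product bijection. [folklore] -/
theorem reindex_prodCongr_kronecker {P' R' : Type*} (εV : ιV ≃ P') (εW : ιW ≃ R') (A : Matrix ιV ιV ℂ)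
    (B : Matrix ιW ιW ℂ) :
    Matrix.reindex (εV.prodCongr εW) (εV.prodCongr εW) (A ⊗ₖ B) = Matrix.reindex εV εV A ⊗ₖ Matrix.reindex εW εW B :=
  (Matrix.kroneckerMap_reindex _ εV εV εW εW A B).symm

/-- `reindex (a.trans b) = reindex b ∘ reindex a` on square matrices. [folklore] -/
theorem reindex_trans_eq {m₁ m₂ m₃ : Type*} (a : m₁ ≃ m₂) (b : m₂ ≃ m₃) (X : Matrix m₁ m₁ ℂ) :
    Matrix.reindex (a.trans b) (a.trans b) X = Matrix.reindex b b (Matrix.reindex a a X) :=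
  Matrix.ext fun _ _ => rfl

/-- `reindex e⁻¹ (reindex e X) = X`. [folklore] -/
theorem reindex_symm_reindex {m₁ m₂ : Type*} (e : m₁ ≃ m₂) (X : Matrix m₁ m₁ ℂ) :
    Matrix.reindex e.symm e.symm (Matrix.reindex e e X) = X :=
  Matrix.ext fun i j => by simp only [Matrix.reindex_apply, Matrix.submatrix_apply, Equiv.symm_symm,
    Equiv.symm_apply_apply]

variable (P Q R S) in
/-- **The product sign frame** of `V ⊗ W`: the index `ι ≃ ιV × ιW` sorted, via the sign frames `ε_V : ιV ≃ P ⊕ Q`,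
`ε_W : ιW ≃ R ⊕ S` of the factors, into Konno–Konno's block index `DPIdx P Q R S` (same-sign blocks `P × R`, `Q × S`
first = the `+1` coordinates of the product form, then the mixed ones). [cite: KonnoKonno2007, §3.1] -/
def pairFrame (e : ιV × ιW ≃ ι) (εV : ιV ≃ P ⊕ Q) (εW : ιW ≃ R ⊕ S) : ι ≃ DPIdx P Q R S :=
  (e.symm.trans (εV.prodCongr εW)).trans (dpEquiv P Q R S)

/-- the sign of `dpEquiv (x, y)` is the product of the signs. [folklore] -/
theorem signOf_dpEquiv (x : P ⊕ Q) (y : R ⊕ S) : signOf (dpEquiv P Q R S (x, y)) = signOf x * signOf y := by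
  rcases x with p | q <;> rcases y with r | s
  · show (1 : ℝ) = 1 * 1; norm_num
  · show (-1 : ℝ) = 1 * -1; norm_num
  · show (-1 : ℝ) = -1 * 1; norm_num
  · show (1 : ℝ) = -1 * -1; norm_num

/-- **The sign vector of the product frame is the product of the sign vectors**:
`signOf (pairFrame e εV εW k) = signOf (εV (e⁻¹ k).1) · signOf (εW (e⁻¹ k).2)`. [folklore] -/
theorem signOf_pairFrame (e : ιV × ιW ≃ ι) (εV : ιV ≃ P ⊕ Q) (εW : ιW ≃ R ⊕ S) (k : ι) :
    signOf (pairFrame P Q R S e εV εW k) = signOf (εV (e.symm k).1) * signOf (εW (e.symm k).2) := by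
  rw [pairFrame, Equiv.trans_apply, Equiv.trans_apply, Equiv.prodCongr_apply, Prod.map, signOf_dpEquiv]

/-- **`(D (k₁ ⊗ k₂)^e D⁻¹)` sorted by the product sign frame is the block matrix
`reindex dpEquiv dpEquiv ((D_V k₁ D_V⁻¹)^{ε_V} ⊗ₖ (D_W k₂ D_W⁻¹)^{ε_W})`** — the matrix of Konno–Konno's
`toBig (g₁, g₂)` (`coe_toBig`). [cite: MoeglinVignerasWaldspurger1987, Ch. 1 I.17] -/
theorem reindex_pairFrame_scaleConj (e : ιV × ιW ≃ ι) (εV : ιV ≃ P ⊕ Q) (εW : ιW ≃ R ⊕ S) (DV : ιV → ℝ)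
    (DW : ιW → ℝ) (k₁ : Matrix ιV ιV ℂ) (k₂ : Matrix ιW ιW ℂ) :
    Matrix.reindex (pairFrame P Q R S e εV εW) (pairFrame P Q R S e εV εW)
        (scaleConj (fun k => DV (e.symm k).1 * DW (e.symm k).2) (Matrix.reindex e e (k₁ ⊗ₖ k₂))) =
      Matrix.reindex (dpEquiv P Q R S) (dpEquiv P Q R S)
        (Matrix.reindex εV εV (scaleConj DV k₁) ⊗ₖ Matrix.reindex εW εW (scaleConj DW k₂)) := by
  rw [scaleConj_reindex_kronecker, pairFrame, reindex_trans_eq, reindex_trans_eq, reindex_symm_reindex,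
    reindex_prodCongr_kronecker]

/-- adaptedness of the product scaling `D_V ⊗ D_W` for the product sign frame, from the adaptedness of the factors
(`σ t_V = c_V ε_V D_V²`, `σ t_W = c_W ε_W D_W²`, `c_V c_W = im σ(δ)`). [folklore] -/
theorem adapted_pair (e : ιV × ιW ≃ ι) (εV : ιV ≃ P ⊕ Q) (εW : ιW ≃ R ⊕ S) {DV tV : ιV → ℝ} {DW tW : ιW → ℝ}
    {cV cW : ℝ} (htV : ∀ i, tV i = cV * signOf (εV i) * DV i ^ 2) (htW : ∀ j, tW j = cW * signOf (εW j) * DW j ^ 2)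
    (k : ι) :
    cV * cW * (DV (e.symm k).1 * DW (e.symm k).2) ^ 2 =
      signOf (pairFrame P Q R S e εV εW k) * (tV (e.symm k).1 * tW (e.symm k).2) := by
  rw [signOf_pairFrame, htV, htW]
  rcases signOf_eq_one_or (εV (e.symm k).1) with h1 | h1 <;>
    rcases signOf_eq_one_or (εW (e.symm k).2) with h2 | h2 <;> rw [h1, h2] <;> ring

variable [Fintype ιV] [DecidableEq ιV] [Fintype ιW] [DecidableEq ιW] [Fintype ι] [DecidableEq ι]
  [Fintype P] [DecidableEq P] [Fintype Q] [DecidableEq Q] [Fintype R] [DecidableEq R] [Fintype S] [DecidableEq S]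
variable {Ψ : (ℝ × ℝ) ≃+ ℂ} {δ' : ℂ} {d : ℝ} (h : IsQuadraticCoordinates Complex.ofRealHom Ψ δ' d)
include h

omit [Fintype ιV] [DecidableEq ιV] [Fintype ιW] [DecidableEq ιW] in
/-- **The phase-space map of the dual-pair element `(k₁ ⊗ k₂)^e` in the adapted Folland frame of `diag(t_V ⊗ t_W)`
is `reindexPhase (pairFrame e ε_V ε_W) (ι𝕎 (g₁, g₂))`-shaped**: the twisted realification of the block matrix
`reindex dpEquiv dpEquiv ((D_V k₁ D_V⁻¹)^{ε_V} ⊗ₖ (D_W k₂ D_W⁻¹)^{ε_W})`. [cite: KonnoKonno2007, §3.1 (3.1);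
MoeglinVignerasWaldspurger1987, Ch. 1 I.17; Folland1989, Ch. 4 §1, Prop. (4.6) p. 151] -/
theorem follandScale_resEnd_pair (hre : δ'.re = 0) (e : ιV × ιW ≃ ι) (εV : ιV ≃ P ⊕ Q) (εW : ιW ≃ R ⊕ S)
    {D t : ι → ℝ} {DV tV : ιV → ℝ} {DW tW : ιW → ℝ} {cV cW : ℝ}
    (hDe : ∀ k, D k = DV (e.symm k).1 * DW (e.symm k).2) (hte : ∀ k, t k = tV (e.symm k).1 * tW (e.symm k).2)
    (htV : ∀ i, tV i = cV * signOf (εV i) * DV i ^ 2) (htW : ∀ j, tW j = cW * signOf (εW j) * DW j ^ 2)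
    (hcc : cV * cW = δ'.im) (hDV0 : ∀ i, DV i ≠ 0) (hDW0 : ∀ j, DW j ≠ 0) (k₁ : Matrix ιV ιV ℂ)
    (k₂ : Matrix ιW ιW ℂ) (ab : PV ι) :
    follandScale D t (h.resEnd ι (Matrix.reindex e e (k₁ ⊗ₖ k₂)) ab) =
      reindexPhase (pairFrame P Q R S e εV εW)
        (twRealify (Matrix.reindex (dpEquiv P Q R S) (dpEquiv P Q R S)
          (Matrix.reindex εV εV (scaleConj DV k₁) ⊗ₖ Matrix.reindex εW εW (scaleConj DW k₂))))
        (follandScale D t ab) := by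
  obtain rfl : D = fun k => DV (e.symm k).1 * DW (e.symm k).2 := funext hDe
  obtain rfl : t = fun k => tV (e.symm k).1 * tW (e.symm k).2 := funext hte
  have hD : ∀ k, δ'.im * (fun k => DV (e.symm k).1 * DW (e.symm k).2) k ^ 2 =
      signOf (pairFrame P Q R S e εV εW k) * (fun k => tV (e.symm k).1 * tW (e.symm k).2) k := fun k => by
    rw [← hcc]
    exact adapted_pair e εV εW htV htW k
  rw [follandScale_resEnd_eq_reindexPhase_twRealify h hre (pairFrame P Q R S e εV εW) hD
      (fun k => mul_ne_zero (hDV0 _) (hDW0 _)), reindex_pairFrame_scaleConj]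

end Pair

/-! ## §4 Sylvester: a `diag(t)`-unitary matrix, conjugated by the adapted scaling and sorted by sign, is in `U(P,Q)` -/

section UForm

variable {n : Type*} [Fintype n] [DecidableEq n] {P Q : Type*} [Fintype P] [DecidableEq P] [Fintype Q]
  [DecidableEq Q]

/-- `U(⋆, c • H) = U(⋆, H)` for a real scalar `c ≠ 0`. [folklore] -/
theorem unitaryGroupOfForm_smul_eq (H : Matrix n n ℂ) {c : ℝ} (hc : c ≠ 0) :
    unitaryGroupOfForm (starRingEnd ℂ) ((c : ℂ) • H) = unitaryGroupOfForm (starRingEnd ℂ) H := by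
  ext g
  rw [mem_unitaryGroupOfForm_star_iff_conjTranspose, mem_unitaryGroupOfForm_star_iff_conjTranspose,
    Matrix.mul_smul, Matrix.smul_mul]
  exact (smul_right_injective (Matrix n n ℂ) (Complex.ofReal_ne_zero.2 hc)).eq_iff

omit [Fintype n] [DecidableEq n] [Fintype P] [DecidableEq P] [Fintype Q] [DecidableEq Q] in
/-- `(c • diag(1_P, -1_Q))^ε = diag (c · signOf (ε j))`. [folklore] -/
theorem smul_signForm_submatrix [DecidableEq n] [DecidableEq P] [DecidableEq Q] (ε : n ≃ P ⊕ Q) (c : ℝ) :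
    ((c : ℂ) • signForm P Q).submatrix ε ε = Matrix.diagonal fun j => (c : ℂ) * (signOf (ε j) : ℂ) := by
  rw [signForm_eq_diagonal, ← Matrix.diagonal_smul, Matrix.submatrix_diagonal_equiv]
  refine congrArg Matrix.diagonal (funext fun j => ?_)
  simp only [Function.comp_apply, Pi.smul_apply, smul_eq_mul, ofReal_signOf]

omit [Fintype P] [Fintype Q] in
/-- **The Sylvester datum of the adapted scaling**: `diag(D)ᴴ · (c • diag(1,−1))^ε · diag(D) = diag(t)` when
`t_j = c · signOf(ε j) · D_j²`. [cite: PlatonovRapinchuk1994, §2.3] -/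
theorem formCongr_scaleGL_smul_signForm (ε : n ≃ P ⊕ Q) {D : n → ℝ} (hD0 : ∀ j, D j ≠ 0) (c : ℝ) {t : n → ℝ}
    (ht : ∀ j, t j = c * signOf (ε j) * D j ^ 2) :
    formCongr (starRingEnd ℂ) (scaleGL D hD0) (((c : ℂ) • signForm P Q).submatrix ε ε) =
      (Matrix.diagonal t).map Complex.ofRealHom := by
  rw [formCongr_star, smul_signForm_submatrix, coe_scaleGL, Matrix.diagonal_conjTranspose,
    Matrix.diagonal_mul_diagonal, Matrix.diagonal_mul_diagonal, Matrix.diagonal_map (map_zero _)]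
  refine congrArg Matrix.diagonal (funext fun j => ?_)
  rw [Pi.star_apply, ht j, Complex.star_def, Complex.conj_ofReal, Complex.ofRealHom_eq_coe]
  push_cast
  ring

/-- **`U(⋆, H) →* U(P,Q)`, `k ↦ (diag(D) k diag(D)⁻¹)^ε`**, for a form `H = diag(D)ᴴ (c • diag(1,−1))^ε diag(D)`
isometric (up to the real scalar `c ≠ 0`) to the sign form: conjugation by the Sylvester datum, reindexing by the
sign frame, and `U(c • H₀) = U(H₀)` — a continuous homomorphism (`unitaryGroupOfFormCongrOfEq`,
`unitaryGroupOfFormReindex`). [cite: PlatonovRapinchuk1994, §2.3; MoeglinVignerasWaldspurger1987, Ch. 1 I.17] -/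
def toUForm (ε : n ≃ P ⊕ Q) {D : n → ℝ} (hD0 : ∀ j, D j ≠ 0) {c : ℝ} (hc : c ≠ 0) {H : Matrix n n ℂ}
    (hH : formCongr (starRingEnd ℂ) (scaleGL D hD0) (((c : ℂ) • signForm P Q).submatrix ε ε) = H) :
    unitaryGroupOfForm (starRingEnd ℂ) H →* UForm P Q :=
  (MulEquiv.subgroupCongr (unitaryGroupOfForm_smul_eq (signForm P Q) hc)).toMonoidHom.comp
    ((unitaryGroupOfFormReindex (starRingEnd ℂ) ε ((c : ℂ) • signForm P Q)).toMulEquiv.toMonoidHom.comp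
      (unitaryGroupOfFormCongrOfEq (starRingEnd ℂ) (scaleGL D hD0) (((c : ℂ) • signForm P Q).submatrix ε ε) H
        hH).toMulEquiv.toMonoidHom)

/-- `toUForm ε … k = reindexEquiv ε (diag(D) k diag(D)⁻¹)` in `GL_{P ⊕ Q}(ℂ)`. [folklore] -/
theorem coe_toUForm_GL (ε : n ≃ P ⊕ Q) {D : n → ℝ} (hD0 : ∀ j, D j ≠ 0) {c : ℝ} (hc : c ≠ 0)
    {H : Matrix n n ℂ} (hH : formCongr (starRingEnd ℂ) (scaleGL D hD0) (((c : ℂ) • signForm P Q).submatrix ε ε) = H)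
    (k : unitaryGroupOfForm (starRingEnd ℂ) H) :
    ((toUForm ε hD0 hc hH k : UForm P Q) : GL (P ⊕ Q) ℂ) =
      GLn.reindexEquiv (R := ℂ) ε (scaleGL D hD0 * (k : GL n ℂ) * (scaleGL D hD0)⁻¹) :=
  rfl

/-- the matrix of `toUForm ε … k` is `(D k D⁻¹)^ε = reindex ε ε (scaleConj D k)`. [folklore] -/
@[simp] theorem coe_toUForm (ε : n ≃ P ⊕ Q) {D : n → ℝ} (hD0 : ∀ j, D j ≠ 0) {c : ℝ} (hc : c ≠ 0)
    {H : Matrix n n ℂ} (hH : formCongr (starRingEnd ℂ) (scaleGL D hD0) (((c : ℂ) • signForm P Q).submatrix ε ε) = H)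
    (k : unitaryGroupOfForm (starRingEnd ℂ) H) :
    (((toUForm ε hD0 hc hH k : UForm P Q) : GL (P ⊕ Q) ℂ) : Matrix (P ⊕ Q) (P ⊕ Q) ℂ) =
      Matrix.reindex ε ε (scaleConj D ((k : GL n ℂ) : Matrix n n ℂ)) := by
  rw [coe_toUForm_GL, GLn.coe_reindexEquiv_apply, coe_scaleGL_conj]

/-- `toUForm` is continuous. [folklore] -/
theorem continuous_toUForm (ε : n ≃ P ⊕ Q) {D : n → ℝ} (hD0 : ∀ j, D j ≠ 0) {c : ℝ} (hc : c ≠ 0)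
    {H : Matrix n n ℂ}
    (hH : formCongr (starRingEnd ℂ) (scaleGL D hD0) (((c : ℂ) • signForm P Q).submatrix ε ε) = H) :
    Continuous (toUForm ε hD0 hc hH) := by
  refine continuous_induced_rng.2 ?_
  show Continuous fun k => ((toUForm ε hD0 hc hH k : UForm P Q) : GL (P ⊕ Q) ℂ)
  simp only [coe_toUForm_GL]
  exact (GLn.reindexEquiv (R := ℂ) ε).continuous.comp
    ((continuous_const.mul continuous_subtype_val).mul continuous_const)

end UForm

/-! ## §5 At the real places of a totally real `F` under a CM-type quadratic `E/F` -/

section Adelic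

variable {F : Type} [Field F] [NumberField F] (E : Type) [Field E] [NumberField E] [Algebra F E] (c : E ≃ₐ[F] E)

/-- `σ_{w(v)} (diag(t₀) ⊗ 1) = diag(σ_v t₀) ⊗ 1 ∈ Mₙ(ℂ)` for the complex place `wOf v` over the real place `v`.
[folklore] -/
theorem archLocalForm_diagonal (N : ℕ) (hc : c ≠ 1)
    (wOf : {v : InfinitePlace F // v.IsReal} → {w : InfinitePlace E // w.IsComplex})
    (hw : ∀ v, c • (wOf v).1 = (wOf v).1) (hover : ∀ v, (wOf v).1.comap (algebraMap F E) = v.1)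
    (t₀ : Fin N → F) {J : Matrix (Fin N) (Fin N) E} (hJ : J = (Matrix.diagonal t₀).map (algebraMap F E))
    (v : {v : InfinitePlace F // v.IsReal}) :
    J.map (wOf v).1.embedding = (Matrix.diagonal fun j => embedding_of_isReal v.2 (t₀ j)).map Complex.ofRealHom := by
  rw [UnitaryGroup.archLocalForm_eq_map F E c N (wOf v) (hw v) hc (Matrix.diagonal t₀) hJ,
    Matrix.diagonal_map (map_zero _)]
  exact congrArg (fun f : Fin N → ℝ => (Matrix.diagonal f).map Complex.ofRealHom)
    (funext fun j => realPlaceMap_eq_embedding_of_isReal E c (wOf v) (hw v) hc v (hover v) (t₀ j))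

/-- **`U(J)(𝔸_F) →* U(P_v, Q_v)` at a real place `v`**: the archimedean component at the complex place `wOf v`
(`archAt (wOf v) ∘ archPart`, a `σ_{w(v)}(J) = diag(σ_v t₀)`-unitary matrix), conjugated by the adapted scaling
`diag(D)` and sorted by the sign frame `ε : Fin N ≃ P ⊕ Q` (`σ_v(t₀ j) = c′ · signOf(ε j) · D_j²`) — a continuous
homomorphism. [cite: MoeglinVignerasWaldspurger1987, Ch. 1 I.17; GelbartRogawski1991, §3.1 p. 454] -/
def archUForm (N : ℕ) (hc : c ≠ 1)
    (wOf : {v : InfinitePlace F // v.IsReal} → {w : InfinitePlace E // w.IsComplex})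
    (hw : ∀ v, c • (wOf v).1 = (wOf v).1) (hover : ∀ v, (wOf v).1.comap (algebraMap F E) = v.1)
    (t₀ : Fin N → F) {J : Matrix (Fin N) (Fin N) E} (hJ : J = (Matrix.diagonal t₀).map (algebraMap F E))
    (v : {v : InfinitePlace F // v.IsReal}) {P Q : Type*} [Fintype P] [DecidableEq P] [Fintype Q] [DecidableEq Q]
    (ε : Fin N ≃ P ⊕ Q) {D : Fin N → ℝ} (hD0 : ∀ j, D j ≠ 0) {c' : ℝ} (hc' : c' ≠ 0)
    (ht : ∀ j, embedding_of_isReal v.2 (t₀ j) = c' * signOf (ε j) * D j ^ 2) :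
    UnitaryGroup.adelic F E c N J →* UForm P Q :=
  (toUForm ε hD0 hc' ((formCongr_scaleGL_smul_signForm ε hD0 c' ht).trans
      (archLocalForm_diagonal E c N hc wOf hw hover t₀ hJ v).symm)).comp
    ((archAt F E c N J (wOf v) (hw v) hc).comp (archPart F E c N J))

/-- the matrix of `archUForm … v … u` is `reindex ε ε (scaleConj D (u_{w(v)}))`, `u_{w(v)} = archAt (wOf v) (archPart u)`.
[folklore] -/
theorem coe_archUForm (N : ℕ) (hc : c ≠ 1)
    (wOf : {v : InfinitePlace F // v.IsReal} → {w : InfinitePlace E // w.IsComplex})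
    (hw : ∀ v, c • (wOf v).1 = (wOf v).1) (hover : ∀ v, (wOf v).1.comap (algebraMap F E) = v.1)
    (t₀ : Fin N → F) {J : Matrix (Fin N) (Fin N) E} (hJ : J = (Matrix.diagonal t₀).map (algebraMap F E))
    (v : {v : InfinitePlace F // v.IsReal}) {P Q : Type*} [Fintype P] [DecidableEq P] [Fintype Q] [DecidableEq Q]
    (ε : Fin N ≃ P ⊕ Q) {D : Fin N → ℝ} (hD0 : ∀ j, D j ≠ 0) {c' : ℝ} (hc' : c' ≠ 0)
    (ht : ∀ j, embedding_of_isReal v.2 (t₀ j) = c' * signOf (ε j) * D j ^ 2) (u : UnitaryGroup.adelic F E c N J) :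
    (((archUForm E c N hc wOf hw hover t₀ hJ v ε hD0 hc' ht u : UForm P Q) : GL (P ⊕ Q) ℂ) :
        Matrix (P ⊕ Q) (P ⊕ Q) ℂ) =
      Matrix.reindex ε ε (scaleConj D
        (((archAt F E c N J (wOf v) (hw v) hc (archPart F E c N J u) : archLocal E N J (wOf v)) : GL (Fin N) ℂ) :
          Matrix (Fin N) (Fin N) ℂ)) :=
  coe_toUForm ε hD0 hc' _ _

/-- `archUForm` is continuous. [folklore] -/
theorem continuous_archUForm (N : ℕ) (hc : c ≠ 1)
    (wOf : {v : InfinitePlace F // v.IsReal} → {w : InfinitePlace E // w.IsComplex})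
    (hw : ∀ v, c • (wOf v).1 = (wOf v).1) (hover : ∀ v, (wOf v).1.comap (algebraMap F E) = v.1)
    (t₀ : Fin N → F) {J : Matrix (Fin N) (Fin N) E} (hJ : J = (Matrix.diagonal t₀).map (algebraMap F E))
    (v : {v : InfinitePlace F // v.IsReal}) {P Q : Type*} [Fintype P] [DecidableEq P] [Fintype Q] [DecidableEq Q]
    (ε : Fin N ≃ P ⊕ Q) {D : Fin N → ℝ} (hD0 : ∀ j, D j ≠ 0) {c' : ℝ} (hc' : c' ≠ 0)
    (ht : ∀ j, embedding_of_isReal v.2 (t₀ j) = c' * signOf (ε j) * D j ^ 2) :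
    Continuous (archUForm E c N hc wOf hw hover t₀ hJ v ε hD0 hc' ht) :=
  (continuous_toUForm ε hD0 hc' _).comp
    ((continuous_archAt F E c N J (wOf v) (hw v) hc).comp (continuous_archPart F E c N J))

variable (N M : ℕ) {m : ℕ} (e : Fin N × Fin M ≃ Fin m) (hc : c ≠ 1)
  (wOf : {v : InfinitePlace F // v.IsReal} → {w : InfinitePlace E // w.IsComplex})
  (hw : ∀ v, c • (wOf v).1 = (wOf v).1) (hover : ∀ v, (wOf v).1.comap (algebraMap F E) = v.1)
  (tV : Fin N → F) (tW : Fin M → F) {JV : Matrix (Fin N) (Fin N) E} {JW : Matrix (Fin M) (Fin M) E}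
  (hJV : JV = (Matrix.diagonal tV).map (algebraMap F E)) (hJW : JW = (Matrix.diagonal tW).map (algebraMap F E))
  {P Q R S : {v : InfinitePlace F // v.IsReal} → Type*} [∀ v, Fintype (P v)] [∀ v, DecidableEq (P v)]
  [∀ v, Fintype (Q v)] [∀ v, DecidableEq (Q v)] [∀ v, Fintype (R v)] [∀ v, DecidableEq (R v)]
  [∀ v, Fintype (S v)] [∀ v, DecidableEq (S v)]
  (εV : ∀ v, Fin N ≃ P v ⊕ Q v) (εW : ∀ v, Fin M ≃ R v ⊕ S v)
  {DV : {v : InfinitePlace F // v.IsReal} → Fin N → ℝ} {DW : {v : InfinitePlace F // v.IsReal} → Fin M → ℝ}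
  (hDV0 : ∀ v i, DV v i ≠ 0) (hDW0 : ∀ v j, DW v j ≠ 0) {cV cW : {v : InfinitePlace F // v.IsReal} → ℝ}
  (hcV : ∀ v, cV v ≠ 0) (hcW : ∀ v, cW v ≠ 0)
  (htV : ∀ v i, embedding_of_isReal v.2 (tV i) = cV v * signOf (εV v i) * DV v i ^ 2)
  (htW : ∀ v j, embedding_of_isReal v.2 (tW j) = cW v * signOf (εW v j) * DW v j ^ 2)

/-- **`archPairPlace v : U(J_V)(𝔸_F) × U(J_W)(𝔸_F) →* U(P_v,Q_v) × U(R_v,S_v) = Ginf`** — the archimedean components of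
the pair at the complex place over `v`, in the sign frames. [cite: KonnoKonno2007, §3.1 (3.1); GelbartRogawski1991,
§3.1 p. 454] -/
def archPairPlace (v : {v : InfinitePlace F // v.IsReal}) :
    UnitaryGroup.adelic F E c N JV × UnitaryGroup.adelic F E c M JW →* Ginf (P v) (Q v) (R v) (S v) :=
  (archUForm E c N hc wOf hw hover tV hJV v (εV v) (hDV0 v) (hcV v) (htV v)).prodMap
    (archUForm E c M hc wOf hw hover tW hJW v (εW v) (hDW0 v) (hcW v) (htW v))

/-- `archPairPlace v` is continuous. [folklore] -/
theorem continuous_archPairPlace (v : {v : InfinitePlace F // v.IsReal}) :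
    Continuous (archPairPlace E c N M hc wOf hw hover tV tW hJV hJW εV εW hDV0 hDW0 hcV hcW htV htW v) :=
  (continuous_archUForm E c N hc wOf hw hover tV hJV v (εV v) (hDV0 v) (hcV v) (htV v)).prodMap
    (continuous_archUForm E c M hc wOf hw hover tW hJW v (εW v) (hDW0 v) (hcW v) (htW v))

/-- all places at once: `p ↦ (archPairPlace v p)_v`, continuous. [folklore] -/
theorem continuous_archPairPlace_pi :
    Continuous fun (p : UnitaryGroup.adelic F E c N JV × UnitaryGroup.adelic F E c M JW)
      (v : {v : InfinitePlace F // v.IsReal}) =>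
        archPairPlace E c N M hc wOf hw hover tV tW hJV hJW εV εW hDV0 hDW0 hcV hcW htV htW v p :=
  continuous_pi fun v =>
    continuous_archPairPlace E c N M hc wOf hw hover tV tW hJV hJW εV εW hDV0 hDW0 hcV hcW htV htW v

variable {e} in
/-- **The product scaling** `D_{(k, v)} = D_V v (e⁻¹ k)₁ · D_W v (e⁻¹ k)₂` of the scaled Folland frame of `𝕎 = V ⊗ W`.
[folklore] -/
abbrev pairScale (DV : {v : InfinitePlace F // v.IsReal} → Fin N → ℝ)
    (DW : {v : InfinitePlace F // v.IsReal} → Fin M → ℝ) :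
    Fin m × {v : InfinitePlace F // v.IsReal} → ℝ :=
  fun k => DV k.2 (e.symm k.1).1 * DW k.2 (e.symm k.1).2

omit [NumberField F] in
variable {e} in
/-- `pairScale` does not vanish. [folklore] -/
theorem pairScale_ne_zero (hDV0 : ∀ v i, DV v i ≠ 0) (hDW0 : ∀ v j, DW v j ≠ 0) :
    ∀ k, pairScale N M (e := e) DV DW k ≠ 0 := fun _ => mul_ne_zero (hDV0 _ _) (hDW0 _ _)

omit [∀ v, DecidableEq (P v)] [∀ v, DecidableEq (Q v)] [∀ v, DecidableEq (R v)] [∀ v, DecidableEq (S v)] in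
/-- the phase map `⇑(ι𝕎 g).1` of a pair element is the twisted realification of the block matrix (function form of
`ι𝕎_apply`). [folklore] -/
theorem coe_ι𝕎_fst {P Q R S : Type*} [Fintype P] [DecidableEq P] [Fintype Q] [DecidableEq Q] [Fintype R]
    [DecidableEq R] [Fintype S] [DecidableEq S] (g : Ginf P Q R S) :
    (⇑(ι𝕎 P Q R S g).1 : PhaseMap (DPIdx P Q R S)) =
      twRealify (Matrix.reindex (dpEquiv P Q R S) (dpEquiv P Q R S)
        (((g.1 : GL (P ⊕ Q) ℂ) : Matrix (P ⊕ Q) (P ⊕ Q) ℂ) ⊗ₖ ((g.2 : GL (R ⊕ S) ℂ) : Matrix (R ⊕ S) (R ⊕ S) ℂ))) :=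
  funext fun w => ι𝕎_apply g w

variable [IsTotallyReal F] [Algebra.IsQuadraticExtension F E] {δ : E} (hcδ : c δ = -δ) (hδ : δ ≠ 0) {d : F}
  (hd : δ * δ = algebraMap F E d) (hV : (Matrix.diagonal tV).IsSymm) (hW : (Matrix.diagonal tW).IsSymm)

/-- **The dictionary, at every real place.**  For `u₁ ∈ U(J_V)(𝔸_F)`, `u₂ ∈ U(J_W)(𝔸_F)` (`J_V = diag(t_V) ⊗ 1`,
`J_W = diag(t_W) ⊗ 1`), the `v`-slices of the archimedean pair `Ξ(archAct 𝕋 (ι(u₁ ⊗ 1 · 1 ⊗ u₂)) (a, b))` in the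
scaled Folland frame `e_D`, `D = D_V ⊗ D_W` adapted place by place (`σ_v t_V = c_V ε_V D_V²`, `σ_v t_W = c_W ε_W D_W²`,
`c_V c_W = im σ_{w(v)}(δ)`), are `reindexPhase (pairFrame e ε_V ε_W) (ι𝕎 (archPairPlace v (u₁, u₂)))` applied to
the `v`-slices of `Ξ(a, b)`: the archimedean action of the adelic unitary dual pair IS, place by place and up to the
relabelling `pairFrame`, Konno–Konno's real dual pair `ι𝕎 : U(P,Q) × U(R,S) → Sp(𝕎)`.
[cite: GelbartRogawski1991, §3.1 p. 454; KonnoKonno2007, §3.1 (3.1); MoeglinVignerasWaldspurger1987, Ch. 1 I.17;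
Folland1989, Ch. 4 §1, Prop. (4.6) p. 151] -/
theorem archFolland_archAct_toSp_pair_slice (hcc : ∀ v, cV v * cW v = ((wOf v).1.embedding δ).im)
    (v : {v : InfinitePlace F // v.IsReal}) (u₁ : UnitaryGroup.adelic F E c N JV) (u₂ : UnitaryGroup.adelic F E c M JW) (a b : Fin m → mixedSpace F) :
    ((fun j => (archFolland (GelbartRogawski1991.UnitaryDualPair.adelicGram F e (Matrix.diagonal tV)
          (Matrix.diagonal tW)) (scaledFrame F (Fin m) (pairScale N M (e := e) DV DW)
            (pairScale_ne_zero N M hDV0 hDW0))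
        (archAct (GelbartRogawski1991.UnitaryDualPair.adelicGram F e (Matrix.diagonal tV) (Matrix.diagonal tW))
          (GelbartRogawski1991.UnitaryDualPair.toSp F E c N M e JV JW hcδ hδ hd hV hW hJV hJW
            (adelicInl F E c N M JV JW u₁ * adelicInr F E c N M JV JW u₂)) (a, b))).1 (j, v)),
      (fun j => (archFolland (GelbartRogawski1991.UnitaryDualPair.adelicGram F e (Matrix.diagonal tV)
          (Matrix.diagonal tW)) (scaledFrame F (Fin m) (pairScale N M (e := e) DV DW)
            (pairScale_ne_zero N M hDV0 hDW0))
        (archAct (GelbartRogawski1991.UnitaryDualPair.adelicGram F e (Matrix.diagonal tV) (Matrix.diagonal tW))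
          (GelbartRogawski1991.UnitaryDualPair.toSp F E c N M e JV JW hcδ hδ hd hV hW hJV hJW
            (adelicInl F E c N M JV JW u₁ * adelicInr F E c N M JV JW u₂)) (a, b))).2 (j, v))) =
      reindexPhase (pairFrame (P v) (Q v) (R v) (S v) e (εV v) (εW v))
        (⇑(ι𝕎 (P v) (Q v) (R v) (S v)
          (archPairPlace E c N M hc wOf hw hover tV tW hJV hJW εV εW hDV0 hDW0 hcV hcW htV htW v (u₁, u₂))).1)
        ((fun j => (archFolland (GelbartRogawski1991.UnitaryDualPair.adelicGram F e (Matrix.diagonal tV)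
            (Matrix.diagonal tW)) (scaledFrame F (Fin m) (pairScale N M (e := e) DV DW)
              (pairScale_ne_zero N M hDV0 hDW0)) (a, b)).1 (j, v)),
          (fun j => (archFolland (GelbartRogawski1991.UnitaryDualPair.adelicGram F e (Matrix.diagonal tV)
            (Matrix.diagonal tW)) (scaledFrame F (Fin m) (pairScale N M (e := e) DV DW)
              (pairScale_ne_zero N M hDV0 hDW0)) (a, b)).2 (j, v))) := by
  have hT := GelbartRogawski1991.UnitaryDualPair.adelicGram_diagonal F e tV tW
  set g := GelbartRogawski1991.UnitaryDualPair.toSp F E c N M e JV JW hcδ hδ hd hV hW hJV hJW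
    (adelicInl F E c N M JV JW u₁ * adelicInr F E c N M JV JW u₂) with hg
  rw [show archAct _ g (a, b) = ((archAct _ g (a, b)).1, (archAct _ g (a, b)).2) from rfl,
    archFolland_scaledFrame _ hT, archFolland_scaledFrame _ hT, hg,
    placeVec_archAct_toSp_inl_mul_inr F E c N M e hcδ hδ hc hd hV hW hJV hJW v (wOf v) (hw v) (hover v)
      (UnitaryGroup.re_embedding_delta F E c (wOf v) (hw v) hc hcδ)
      (UnitaryGroup.im_embedding_delta_ne_zero F E c (wOf v) (hw v) hc hcδ hδ) u₁ u₂ a b,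
    coe_ι𝕎_fst]
  simp only [archPairPlace, MonoidHom.coe_prodMap, Prod.map_apply, coe_archUForm]
  exact follandScale_resEnd_pair (isQuadraticCoordinates_complex ((wOf v).1.embedding δ) _ _)
    (UnitaryGroup.re_embedding_delta F E c (wOf v) (hw v) hc hcδ) e (εV v) (εW v)
    (tV := fun i => embedding_of_isReal v.2 (tV i)) (tW := fun j => embedding_of_isReal v.2 (tW j))
    (fun k => rfl) (fun k => map_mul _ _ _) (htV v) (htW v) (hcc v) (hDV0 v) (hDW0 v) _ _ _

end Adelic

end Literature.NumberTheory.Weil1964
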